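import Mathlib
import HarnessLib
import HarnessLib.Audit
import Summits.FinalStateConjecture.Statement
import HarnessLib.Audit.Status.Attr

/-!
Route: RootDecompMultiplicityCells

# Route RootDecompMultiplicityCells — Root decomposition N4b «MultiplicityCells» — N4 with the
settling-adherent residual cut by final multiplicity (scattering ∧ pure ∧ degenerate ∧ dispersive
thresholds ∧ no stable counterexample)

DECOMPOSITION CELL decomp-fsc (D-0178; doctrine D-0170/0171/0172), summit S =
`_root_.FinalStateConjecture` exactly as typed; LADDER rung 0 — NOTHING IN THIS FILE PROVES THE
FINAL STATE CONJECTURE. OR-SIBLING REFINEMENT of Theses/RootDecompAdjacencyCells.lean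
(route-FinalStateConjecture-RootDecompAdjacencyCells, node N4 «MinimalCounterexampleCells», whose
cell II SettlingAdherentCurable stmt-FinalStateConjecture-24910 carries the filed gen-1 split
RobustThresholdCurable stmt-25216 ∧ DegenerateThresholdCurable stmt-25217): this file = node N4b
«MultiplicityCells» = lens decomp-fsc-lens-4 gen 3 «MultiplicityGradedThresholds», CLEARED by the
critic decomp-fsc-crit-1-g0 2026-08-30T02:55:40Z. FILING FORM: the critic ruled (a) `--resplit
SettlingAdherentCurable --into Sc Pu D`; the gate refused the writer seat («resplit: only the
route's tenure planner or the operator», nothing recorded, writer NOTE 02:58Z on HOME/STATUS.md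
asking the operator for a tenure grant); this thin sibling route is the writer-executable form (B′)
mirroring the critic's ruling (α) for Theses/RootDecompTrappedBasinCells.lean: `closes` takes the
two untouched N4 cells and D BY SIGNATURE (stmt-24909 DispersiveThresholdCurable, stmt-24908
NoStableCounterexample, stmt-25217 DegenerateThresholdCurable — dedup-attached, not re-filed) and
the two NEW cells; R = stmt-25216 stays alive on the parent route as the exact conjunction Sc ∧ Pu
(lens kernel `split_iff`; writer `robustThresholdCurable_of_cells`) — DOMINATION POINTER for provers
served R: «Sc ∧ Pu ⟺ R (stmt-25216); attack ScatteringThresholdCurable / PureThresholdCurable here,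
not R» (critic ruling 03:00:14Z; request (A) = operator tenure grant for the ruled resplit stays
standing, after which this route is closed superseded or kept if the gate dedups Sc/Pu by
signature). The whole AND/OR tree is kept in HOME/TREE.md (HOME = run/shared/lean/pub/decomp-fsc).
ROOT AND-node (exact; lens kernel `node_iff` S ⟺ I ∧ (Sc ∧ Pu) ∧ D ∧ III and `resplit_iff` II ⟺ Sc ∧
Pu ∧ D against the born decls, HOME/decomp-fsc-lens-4/MultiplicityGradedThresholds.lean @bc60eb50,
imports only the born tree module; writer kernel `closes`, `robustThresholdCurable_of_cells`,
`settlingAdherentCurable_of_cells` in folder/n4b/Sketch.lean, rc 0 / 0 sorry): S ⟺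
DispersiveThresholdCurable ∧ ScatteringThresholdCurable ∧ PureThresholdCurable ∧
DegenerateThresholdCurable ∧ NoStableCounterexample. The residual cell R = (AdhRob ∧ ¬Adh0)
(exceptional data tamely adherent to ROBUSTLY settling data — remnants with |aᵢ| ≤ χ Mᵢ, Mᵢ ≥ m for
some χ < 1, m > 0 — but not to dispersing data) is cut by the discrete, scale-free invariant FINAL
MULTIPLICITY of the robust NEIGHBOURS: Jump d := ∃ n ≠ n', AdhRobN n d ∧ AdhRobN n' d (RobN = the
born Rob body with «∧ d.N = n» inside the same ∃) — Sc ScatteringThresholdCurable = cell R ∧ Jump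
(the ORBITAL few-body sector: scattering / capture / ejection thresholds between two final
multiplicities; kernel `exists_two_multiplicities_of_jump`, `jump_of_interlaced`), Pu
PureThresholdCurable = cell R ∧ ¬Jump (single-phase strong-field thresholds:
censorship-after-trapping at bounded extremality with spectators, extremal walls with a robust side,
rigidity; kernel `multiplicity_unique_of_not_jump`; the NEW RESIDUAL); continuation of the root's
own n = 0 cut (kernel `adhRobustN_zero_of_adhDisp`). Cure target = P_Σ verbatim in every piece, tame
genericity verbatim. Tags (critic 02:55:40Z): ScatteringThresholdCurable [WEAKER·thin·COUNTS-as-thin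
· INSTRUMENTABLE (box dimension of the final-multiplicity boundary in PN / hyperbolic scattering
with and without 2.5PN reaction) + IDEA-NEEDED (dissipative Conley–Moser exclusion of invariant
scattering sets) · HONEST KILL PATH BY NAME: stmt-FinalStateConjecture-16893 LaminatedThreshold ∧
stmt-16894 TameExitsLocalise at a jump datum — the first piece in the cell with a REGISTERED
negative route against it]; PureThresholdCurable [WEAKER·RESIDUAL-relieved (of the orbital sector) ·
INTERNAL NODE · IDEA-NEEDED; hard cores stmt-17269 / stmt-17308 restricted to one multiplicity
stratum]; DegenerateThresholdCurable / DispersiveThresholdCurable thin, NoStableCounterexample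
COUNTS (their birth tags). No EQUIV layer; no ∀-data binder in `closes` (FinalMassBound is a DOOR
used only in the lens's exhaustiveness remarks, true-in-print territory, never in closes); layer-2
strata remark not filed. Writer typing: every item is ONE line over EXISTING declarations (lets P /
P0 / Adh0 / Rob / AdhRob byte-identical to stmt-25216, new lets RobN / AdhRobN / Jump; one-liners
certified ↔ the node decls by Iff.rfl in HOME/decomp-fsc-lens-4/g3/SplitSketch-g3.lean, my lean
check rc 0). Census: HOME/census/COSTUME-CENSUS-v2.md.
Lean: `DispersiveThresholdCurable ∧ ScatteringThresholdCurable ∧ PureThresholdCurable ∧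
DegenerateThresholdCurable ∧ NoStableCounterexample` (the five decls of this file; exactness
`node_iff` kernel-checked by the lens against the born N4 decls, `closes` in folder/n4b/glue.lean)

## Assembly
Pure logic inside `closes` (folder/n4b/glue.lean, 0 sorry): for an admissible exceptional datum d,
NoStableCounterexample gives tame adherence to the settling data; case on adherence to the
dispersing data (DispersiveThresholdCurable) / else on adherence to ROBUSTLY settling data: if so,
case on Jump (ScatteringThresholdCurable / PureThresholdCurable — excluded middle elaborated against
the cell, no let re-expansion), else DegenerateThresholdCurable; the cure «∀ c ≠ 0, P_Σ (F c)» is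
repackaged as «F c ∉ {d ∈ 𝓓 | ¬P d}». Relations to the parent's nodes by value:
`robustThresholdCurable_of_cells` (Sc → Pu → stmt-25216's statement) and
`settlingAdherentCurable_of_cells` (Sc → Pu → D → stmt-24910's statement).

Rationale: WHY THIS LINE. Population splits of the exceptional set with cure target P are free and exact
(critic `fsc_iff_cellSplit`; tame genericity monotone, not ∧-closed — tree
`isTameChristodoulouGeneric_and_fails`), hence judged on content: the lens's order on
counterexamples is tame ADJACENCY in the summit's own curve class, which separates failure
mechanisms by how a counterexample sits relative to the good data — stable (cell III, conjecturally
empty: every catalogued mechanism is unstable in its model, Christodoulou1999 Thm 4.1 =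
`Literature.Barriers.FinalStateConjecture.nakedSingularityInstability`; Aretakis; Anderson
doi:10.1007/PL00001021), at the dispersion/collapse threshold (cell I: critical collapse,
Gundlach–Martín-García arXiv:0711.4620; Luk–Oh arXiv:2108.13379 Thm 1.3 openness of dispersion among
decaying solutions; Kehle–Unger arXiv:2402.10190 B_crit), or adherent to settling data but isolated
from dispersion (cell II: extremal, merge/scatter and N-jump thresholds, Pretorius–Khurana
gr-qc/0702084 zoom–whirl). Imported: the minimal-counterexample heuristic of extremal combinatorics
as an ORDER on data (adjacency), nothing analytic. What it does that prior routes do not: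
LaminatedThreshold / RobustClausewiseGenericity study density-versus-codimension as a refutation
theme for ALL data; here density is the S-implied piece III and the two threshold cells carry the
codimension content, with typed roads (smooth one-sided graph access + a kernel bending lemma) kept
outside `closes`. GEN-3 DELTA (this file): the residual is graded by what the datum's robust
NEIGHBOURS settle to (their final multiplicity), never by the datum's own development — orthogonal
by construction to the fate cuts of N2/N2b/N5 and to N1's Sobolev tubes; the orbital few-body sector
(Alekseev–Moser capture sets, fractal basin boundaries arXiv:gr-qc/9910040, zoom–whirl
arXiv:gr-qc/0702084, doubly transient chaos arXiv:1310.4209) is isolated in ONE thin piece with a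
registered kill path, so the bet «gravitational-wave dissipation de-laminates» is refutable on its
own.

RANKED CRUXES. #2 PureThresholdCurable (crux) — PIECE Pu — gen-3 lens-4 child Pu = the NEW RESIDUAL
relieved of the orbital sector [WEAKER·RESIDUAL·INTERNAL NODE · IDEA-NEEDED — critic CLEARED
2026-08-30T02:55:40Z]: PURE ROBUST THRESHOLDS ARE CURABLE — for every Σ, through every admissible
datum failing P_Σ which is a tame limit of robustly settling data, not of dispersing data, and NOT a
multiplicity jump (every adjacent robust phase has the same final multiplicity, kernel
multiplicity_unique_of_not_jump; exactly one under the UNDECIDED door FinalMassBound, which is NOT a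
binder), passes a tame, immersed, injective admissible cure to P_Σ. Content:
censorship-after-trapping at bounded extremality with spectators, extremal walls with a robust side,
rigidity; hard cores stmt-FinalStateConjecture-17269 / stmt-17308 restricted to one multiplicity
stratum. Lets as in Sc. [difficulty: open-problem] (why it might fail: generic naked-singularity
data adjacent to ONE robust collapse phase whose collapsing neighbours accumulate only along
laminated parameter sets (non-universal critical behaviour in one stratum), or a non-Kerr stationary
exterior that no tame curve leaves.) [Christodoulou1999, arXiv:2104.11857, arXiv:2402.10190,
arXiv:2211.15742]
#3 ScatteringThresholdCurable (crux) — PIECE Sc — gen-3 lens-4 MultiplicityGradedThresholds child Sc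
of the residual R = RobustThresholdCurable (stmt-FinalStateConjecture-25216, which stays on the
parent route as the exact conjunction Sc ∧ Pu, kernel split_iff) [WEAKER·thin·INSTRUMENTABLE +
IDEA-NEEDED — critic CLEARED 2026-08-30T02:55:40Z: COUNTS-as-thin; first piece in the cell with a
REGISTERED negative route against it (stmt-16893 ∧ stmt-16894)]: SCATTERING THRESHOLDS (MULTIPLICITY
JUMPS) ARE CURABLE — for every Σ, through every admissible datum failing P_Σ which is a tame limit
of robustly settling data (AdhRob), not a tame limit of dispersing data (¬Adh0), and at which robust
phases of TWO DIFFERENT final multiplicities n ≠ n' are adjacent (Jump: AdhRobN n ∧ AdhRobN n'),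
passes a tame (order 1 at one end), immersed-at-0, injective admissible curve all of whose members
off 0 satisfy P_Σ. = the ORBITAL few-body sector (scattering / capture / ejection thresholds);
kernel exists_two_multiplicities_of_jump, jump_of_interlaced
(HOME/decomp-fsc-lens-4/MultiplicityGradedThresholds.lean). Kill path BY NAME:
stmt-FinalStateConjecture-16893 LaminatedThreshold ∧ stmt-16894 TameExitsLocalise at a jump datum.
Lets P / P0 / Adh0 / Rob / AdhRob byte-identical to stmt-25216; new lets RobN / AdhRobN / Jump.
[difficulty: open-problem] (why it might fail: an eternal vacuum few-black-hole scattering-threshold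
solution (three-body / hyperbolic analogue of the Alekseev–Moser capture Cantor set,
arXiv:gr-qc/9910040) surviving radiation reaction, its two robust multiplicities interlacing along
every tame curve — no cure.) [arXiv:gr-qc/0702084, arXiv:1207.5167, arXiv:1310.4209,
arXiv:gr-qc/9910040, isbn:9780691089102]
#4 DegenerateThresholdCurable (crux) — = the filed gen-1 child stmt-FinalStateConjecture-25217 of
the parent route reused BY SIGNATURE (dedup-attach), text as filed: [crux · gen-2 glued split of
SettlingAdherentCurable (stmt-24910), lens-4 g2; WEAKER·thin·BARRIER (AretakisInstability declared
inside); leaf IDEA-NEEDED + INSTRUMENTABLE (census T-X1 max remnant spin in one-ended vacuum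
collapse; T-X2 EMCSF extremal leaves); registered statement in its direction
stmt-FinalStateConjecture-10606 PhaseMixingCapture.NearExtremalKappaCapture cited by name; lens
kernel certificates exists_nearExtremal_remnant_of_adhMacro, not_adhMacro_of_gap] For every Σ and
every admissible P_Σ-exceptional datum d which is a tame limit of settling admissible data but of NO
robust class G_(χ,m) (χ < 1, m > 0) — along every admissible tame curve through d the settling
members' remnants extremalise (|aᵢ|/Mᵢ → 1) or evanesce (Mᵢ → 0) — there are one end e and a tame
immersed injective admissible one-parameter family F with F 0 = d whose members c ≠ 0 satisfy P_Σ.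
(= stmt-FinalStateConjecture-25217, kept BY SIGNATURE through the gen-3 resplit) [difficulty:
open-problem] (why it might fail: at a vacuum extremal wall not adjacent to dispersion (third-law /
overspinning threshold) the only settling neighbours are near-extremal and the Aretakis instability
may make the settling side fail to be one-sidedly tame-open, leaving no punctured curve of settling
data.) [arXiv:2402.10190, arXiv:2601.20955, arXiv:1110.2007, arXiv:2211.15742]
#5 DispersiveThresholdCurable (crux) — = the BORN N4 item stmt-FinalStateConjecture-24909 reused BY
SIGNATURE (dedup-attach), text as born: PIECE I — DispersiveThresholdCurable [WEAKER·thin — critic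
CLEARED 2026-08-30T01:32:59Z; leaf IDEA-NEEDED + INSTRUMENTABLE (NR test: regularity of the vacuum
collapse threshold in 2-parameter Brill/Teukolsky-wave families, 50–150 core-h, unrun); road
SmoothDispersiveThreshold → piece (lens kernel `dispersiveThresholdCurable_of_smooth` via the
bending lemma `cellEsc_of_graphAccess`) UNDECIDED, outside closes]. For every Σ and every admissible
P_Σ-exceptional datum d which is tamely adherent to the DISPERSING data (some tame immersed curve of
admissible data based at d carries, at parameters accumulating at 0, data all of whose MGHDs have
complete 𝓘⁺ and an honest decomposition with N = 0 final holes and the Statement's clauses), there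
are one end e and a tame immersed injective one-parameter family F of admissible data with F 0 = d
whose members c ≠ 0 satisfy P_Σ. [difficulty: open-problem] (why it might fail: a laminated /
fractal vacuum collapse threshold (non-universal critical behaviour) leaves a two-sided accumulating
exceptional stratum at a critical datum which no immersed tame curve escapes (route
LaminatedThreshold crux A).) [arXiv:0711.4620, arXiv:2108.13379, arXiv:2402.10190,
Christodoulou1999]
#6 NoStableCounterexample (crux) — = the BORN N4 item stmt-FinalStateConjecture-24908 reused BY
SIGNATURE (dedup-attach), text as born: PIECE III — NoStableCounterexample [WEAKER·COUNTS — critic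
CLEARED 2026-08-30T01:32:59Z («tame density; counts»); kernel-equivalent to «cell III (exceptional
data tamely isolated from all settling data) is curable»
(`noStableCounterexample_iff_isolatedCellEmptyCure`); leaf IDEA-NEEDED; BARRIER placement:
HairyKerrBifurcation / GregoryLaflammeInstability show it FALSE in neighbouring models ⇒ vacuum- and
D = 4-specific proof required]. For every Σ and every admissible datum d failing P_Σ there is a tame
(order 1 on one end), immersed-at-0 curve F of admissible data with F 0 = d carrying P_Σ-data at
parameters accumulating at 0 (∃ᶠ c in 𝓝[≠] 0, P_Σ (F c)) — the settling data are tamely dense at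
every exceptional datum; no counterexample is stable. [difficulty: open-problem] (why it might fail:
an as yet unknown STABLE vacuum failure mechanism — a tame-open set of naked-singularity, hairy /
exactly-extremal remnant, or eternal bounded-dynamics data (true in Einstein–Klein–Gordon and in D =
5; no vacuum D = 4 candidate known).) [Christodoulou1999, arXiv:1912.08478, doi:10.1007/PL00001021,
arXiv:2211.15742]

TWO-LAYER PLAN. This route IS the third layer of N4's residual promoted to a thin sibling route
(D-0019 two-layer rule; the ruled resplit on the parent is recorded as operator-pending on
HOME/STATUS.md). Foreseen beneath PureThresholdCurable (not filed): the strata remark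
`pureThresholdCurable_iff_strata` (one multiplicity n per datum under the door FinalMassBound) — gen
≥ 4 cuts by n or by the spectators' fate would again be a sibling route or a tenure resplit.

KILL CRITERIA. All five binders are S-implied in the kernel, so a refutation of any of them (a
tame-open set of stable counterexamples; a laminated two-sided threshold at a critical vacuum datum;
an eternal few-body scattering-threshold solution with interlaced multiplicities = the registered
kill path stmt-16893 ∧ 16894 against ScatteringThresholdCurable) is a refutation of the summit AS
TYPED — it closes this route `refuted:<Decl>` and feeds route LaminatedThreshold / the statement
audit, not a pivot. A refutation of a ROAD (SmoothDispersiveThreshold false: non-smooth but still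
one-sidedly escapable threshold) changes only the layer-2 plan. Superseded if a sibling root
decomposition absorbs the three cells with strictly finer content.

NOT DECOMPOSED YET. PureThresholdCurable (the new residual: single-phase strong-field thresholds,
censorship-after-trapping with spectators, extremal walls with a robust side) is deliberately not
decomposed (internal node, gen ≥ 4); the instrument for cell I (2-parameter threshold regularity in
vacuum NR) is stated, not run; constants none.

CHEAPEST FALSIFIER. NoStableCounterexample: a literature lookup for a STABLE vacuum D = 4 failure
mechanism (stable naked singularity, stable non-Kerr stationary or breathing exterior, stable
exactly-extremal remnant) — none in print (RSR arXiv:1912.08478 fine-tuned; Alexakis–Schlue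
arXiv:1504.04592; black-hole uniqueness literature); the writer re-ran no search beyond the N5/N2
ones (listed under Novelty). DispersiveThresholdCurable: the NR threshold-regularity test (critical
collapse of Brill waves: is the threshold a smooth one-sided hypersurface in 2-parameter families,
or laminated as suggested by non-universality reports [galaxy:pdf:4861896740]?) — unrun, kit_allowed
= false for the writer. SettlingAdherentCurable: Kehle–Unger-type extremal thresholds in the charged
model are smooth hypersurfaces met transversally (arXiv:2402.10190 Conj. 3) — consistent; a kill
needs a Cantor-structured threshold.

NUMBERS. Print only: Choptuik scaling exponent and echoing period for vacuum Brill-wave collapse are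
disputed / non-universal across families ([galaxy:pdf:4861896740]; arXiv:0711.4620 §6), which is
exactly the cell-I risk; remnant spins ≤ 0.95 on open sets (arXiv:1904.04831). No constant enters a
binder.

DEFINITION REQUESTS. None filed. `TameAdh` (tame adherence) is inlined as a `let`; if gen-1 lenses
reuse it, a Literature-level definition `InitialDataSet.IsTamelyAdherent` next to `IsTameDataFamily`
(TameGenericity.lean) would let the items be restated by name (definitionally equal). Shared Frame
for CellEsc (critic must-fix 1) concerns the HOME node files.

Novelty: GEN-3 (2026-08-30T03:0xZ, lens-4 + critic + writer): nearest in-tree = the parent N4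
(route-FinalStateConjecture-RootDecompAdjacencyCells, cells I/II/III and the gen-1 cut R ∧ D of II)
and the registered NEGATIVE routes LaminatedThreshold (stmt-16893/16894) which would sink Sc at a
jump datum; literature for the orbital sector labelled in the Sc docstring
([galaxy:panama:343296735969348 Moser Ch. III Thm 3.5], [corpus:paper:arxiv-gr-qc_9910040 p.3],
[corpus:paper:arxiv-1310.4209 p.2], [corpus:paper:arxiv-1207.5167 p.3]).
Searches (2026-08-30, lens-4 + writer): the sub's Theses files read for density/threshold routes
(nearest: LaminatedThreshold, RobustClausewiseGenericity.PlanarNonClosure stmt-10134 — all-data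
refutation themes; no adjacency split); lit search --hybrid "critical collapse threshold vacuum
Brill waves universality" ([corpus:arxiv-2108.13379 Thm 1.3], [corpus:arxiv-2402.10190 p.4],
[corpus:arxiv-2601.20955 p.4]); lit galaxy search "critical collapse|Choptuik scaling|zoom-whirl"
--star all ([galaxy:pdf:4861896740] non-universal vacuum critical behaviour; textbook hits
otherwise); writer's N5/N2 searches (lit search --hybrid "orbital stability asymptotic stability
Kerr final state generic data extremal third law" 8 docs; lit galaxy search "orbitally
stable|orbital stability of Kerr|final state conjecture" --star all 17 rows; no population-split
hit); ledger negatives --problem FinalStateConjecture (no refuted statement is a cell-cure or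
density statement of this s  [refs: 2402.10190, paper:arxiv-gr-qc_9910040, paper:arxiv-1310.4209, paper:arxiv-1207.5167, arxiv-2108.13379, arxiv-2402.10190, arxiv-2601.20955, Christodoulou1999]

Barriers (technique_class: population-split, tame-adjacency, critical-collapse): - technique_class: population-split, tame-adjacency, critical-collapse
- Literature.Barriers.FinalStateConjecture.nakedSingularityInstability: genericity-blind methods
excluded; all three pieces are GENERIC (tame-curve) forms and piece III is exactly the abstract
shape of the barrier's own theorem (instability of every counterexample) — outside the class.
- Literature.Barriers.FinalStateConjecture.AretakisInstability: bites the extremal-threshold part of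
SettlingAdherentCurable (no uniform-in-spin control up to |a| = M) — declared there (IDEA-NEEDED),
not evaded; DispersiveThresholdCurable and NoStableCounterexample do not quantify over horizon
dynamics.
- Literature.Barriers.FinalStateConjecture.SlowlyRotatingKerrFrontier: printed near-Kerr basins are
not split off as a cell; the residual's closing as typed needs behaviour across the full range —
acknowledged for roads.
- Literature.Barriers.FinalStateConjecture.HairyKerrBifurcation: NoStableCounterexample is FALSE for
Einstein–Klein–Gordon (stable hairy black holes) — the items are VACUUM only; any proof must use the
absence of massive hair (vacuum-specific), acknowledged as the piece's barrier.
- Literature.Barriers.FinalStateConjecture.GregoryLaflammeInstability: likewise FALSE-in-D = 5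
analogue; items are D = 4 — dimension-specific proof required, acknowledged.
- Literature.Barriers.FinalStateConjecture.KerrSuperradiance: decay-estimate barrier for linear
roads; binders are data-side cure/density statements — outside; ro

sub-problem: FinalStateConjecture · status: draft · opened planner-decomp-fsc-writer-1-g0-0 2026-08-30T03:06:06Z · rev 1 · ledger route-FinalStateConjecture-RootDecompMultiplicityCells
GENERATED by the gate from the ledger (D-0016/17). Provers cite these decls: `theorem foo : Summit.FinalStateConjecture.FinalStateConjecture.Theses.RootDecompMultiplicityCells.<Decl> := …` in Summits/FinalStateConjecture/FinalStateConjecture/Theorems/<Name>.lean.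
-/

namespace Summit.FinalStateConjecture.FinalStateConjecture.Theses.RootDecompMultiplicityCells

open scoped BigOperators Topology Manifold Classical MeasureTheory ProbabilityTheory Matrix InnerProductSpace ComplexConjugate ContinuousMap
open Filter Set Function TopologicalSpace MeasureTheory

attribute [summit_statement] _root_.FinalStateConjecture

/-- item stmt-FinalStateConjecture-26250 · crux · rank 2 · SPLIT (gen 1) into GappedThresholdCurable, SoftThresholdCurable + glue PureThresholdCurableGlue · direct attempts still welcome (low priority) · by planner
why it might fail: generic naked-singularity data adjacent to ONE robust collapse phase whose collapsing neighbours accumulate only along laminated parameter sets (non-universal critical behaviour in one stratum), or a non-Kerr stationary exterior that no tame curve leaves.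
sources: Christodoulou1999, arXiv:2104.11857, arXiv:2402.10190, arXiv:2211.15742
[crux] PIECE Pu — gen-3 lens-4 child Pu = the NEW RESIDUAL relieved of the orbital sector
[WEAKER·RESIDUAL·INTERNAL NODE · IDEA-NEEDED — critic CLEARED 2026-08-30T02:55:40Z]: PURE ROBUST
THRESHOLDS ARE CURABLE — for every Σ, through every admissible datum failing P_Σ which is a tame
limit of robustly settling data, not of dispersing data, and NOT a multiplicity jump (every adjacent
robust phase has the same final multiplicity, kernel multiplicity_unique_of_not_jump; exactly one
under the UNDECIDED door FinalMassBound, which is NOT a binder), passes a tame, immersed, injective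
admissible cure to P_Σ. Content: censorship-after-trapping at bounded extremality with spectators,
extremal walls with a robust side, rigidity; hard cores stmt-FinalStateConjecture-17269 / stmt-17308
restricted to one multiplicity stratum. Lets as in Sc. [difficulty: open-problem] -/
@[route_item "route-FinalStateConjecture-RootDecompMultiplicityCells", crux]
def PureThresholdCurable : Prop :=
  ∀ (X : Type) [TopologicalSpace X] [ChartedSpace Literature.Geometry.Lorentzian.E3 X] [IsManifold (𝓡 3) ((⊤ : ℕ∞) : WithTop ℕ∞) X] [T2Space X] [SecondCountableTopology X] [ConnectedSpace X], let P : Literature.Geometry.Lorentzian.InitialDataSet (𝓡 3) X → Prop := fun D ↦ (∃ 𝒟 : Literature.Geometry.Lorentzian.VacuumCauchyDevelopment D, 𝒟.IsMaximal) ∧ ∀ 𝒟 : Literature.Geometry.Lorentzian.VacuumCauchyDevelopment D, 𝒟.IsMaximal → Summit.FinalStateConjecture.HasCompleteNullInfinity 𝒟.toCauchyDevelopment ∧ ∃ (O : Set 𝒟.carrier) (d : Literature.Geometry.Lorentzian.FinalStateDecomposition 𝒟.toSpacetime O 2), (∀ i, Literature.Geometry.Lorentzian.Kerr.IsSubextremal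 (d.mass i) (d.spin i)) ∧ O = Summit.FinalStateConjecture.exteriorOf 𝒟.toCauchyDevelopment d.charted ∧ Summit.FinalStateConjecture.RaysStayInClosure 𝒟.toCauchyDevelopment O ∧ Summit.FinalStateConjecture.HasExhaustiveCharts d ∧ Summit.FinalStateConjecture.IsFutureOriented d; let P0 : Literature.Geometry.Lorentzian.InitialDataSet (𝓡 3) X → Prop := fun D ↦ (∃ 𝒟 : Literature.Geometry.Lorentzian.VacuumCauchyDevelopment D, 𝒟.IsMaximal) ∧ ∀ 𝒟 : Literature.Geometry.Lorentzian.VacuumCauchyDevelopment D, 𝒟.IsMaximal → Summit.FinalStateConjecture.HasCompleteNullInfinity 𝒟.toCauchyDevelopment ∧ ∃ (O : Set 𝒟.carrier) (d : Literature.Geometry.Lorentzian.FinalStateDecomposition 𝒟.toSpacetime O 2), d.N = 0 ∧ (∀ i, Literature.Geometry.Lorentzian.Kerr.IsSubextremal (d.mass i) (d.spin i)) ∧ O = Summit.FinalStateConjecture.exteriorOf 𝒟.toCauchyDevelopment d.charted ∧ Summit.FinalStateConjecture.RaysStayInClosure 𝒟.toCauchyDevelopment O ∧ Summit.FinalStateConjecture.HasExhaustiveCharts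 d ∧ Summit.FinalStateConjecture.IsFutureOriented d; let Adh0 : Literature.Geometry.Lorentzian.InitialDataSet (𝓡 3) X → Prop := fun d ↦ ∃ (e : Literature.Geometry.Lorentzian.AFEnd X) (F : EuclideanSpace ℝ (Fin 1) → Literature.Geometry.Lorentzian.InitialDataSet (𝓡 3) X), Literature.Geometry.Lorentzian.InitialDataSet.IsTameDataFamily e 1 F ∧ Literature.Geometry.Lorentzian.InitialDataSet.IsImmersedAtZero 1 F ∧ F 0 = d ∧ (∀ c, F c ∈ Literature.Geometry.Lorentzian.admissibleVacuumData X) ∧ ∃ᶠ c in 𝓝[≠] (0 : EuclideanSpace ℝ (Fin 1)), P0 (F c); let Rob : ℝ → ℝ → Literature.Geometry.Lorentzian.InitialDataSet (𝓡 3) X → Prop := fun χ m D ↦ P D ∧ ∃ 𝒟 : Literature.Geometry.Lorentzian.VacuumCauchyDevelopment D, 𝒟.IsMaximal ∧ ∃ (O : Set 𝒟.carrier) (d : Literature.Geometry.Lorentzian.FinalStateDecomposition 𝒟.toSpacetime O 2), (∀ i, Literature.Geometry.Lorentzian.Kerr.IsSubextremal (d.mass i) (d.spin i)) ∧ O = Summit.FinalStateConjecture.exteriorOf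 𝒟.toCauchyDevelopment d.charted ∧ Summit.FinalStateConjecture.RaysStayInClosure 𝒟.toCauchyDevelopment O ∧ Summit.FinalStateConjecture.HasExhaustiveCharts d ∧ Summit.FinalStateConjecture.IsFutureOriented d ∧ ∀ i, |d.spin i| ≤ χ * d.mass i ∧ m ≤ d.mass i; let AdhRob : Literature.Geometry.Lorentzian.InitialDataSet (𝓡 3) X → Prop := fun d ↦ ∃ χ : ℝ, χ < 1 ∧ ∃ m : ℝ, 0 < m ∧ ∃ (e : Literature.Geometry.Lorentzian.AFEnd X) (F : EuclideanSpace ℝ (Fin 1) → Literature.Geometry.Lorentzian.InitialDataSet (𝓡 3) X), Literature.Geometry.Lorentzian.InitialDataSet.IsTameDataFamily e 1 F ∧ Literature.Geometry.Lorentzian.InitialDataSet.IsImmersedAtZero 1 F ∧ F 0 = d ∧ (∀ c, F c ∈ Literature.Geometry.Lorentzian.admissibleVacuumData X) ∧ ∃ᶠ c in 𝓝[≠] (0 : EuclideanSpace ℝ (Fin 1)), Rob χ m (F c); let RobN : ℝ → ℝ → ℕ → Literature.Geometry.Lorentzian.InitialDataSet (𝓡 3) X → Prop := fun χ m n D ↦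 P D ∧ ∃ 𝒟 : Literature.Geometry.Lorentzian.VacuumCauchyDevelopment D, 𝒟.IsMaximal ∧ ∃ (O : Set 𝒟.carrier) (d : Literature.Geometry.Lorentzian.FinalStateDecomposition 𝒟.toSpacetime O 2), (∀ i, Literature.Geometry.Lorentzian.Kerr.IsSubextremal (d.mass i) (d.spin i)) ∧ O = Summit.FinalStateConjecture.exteriorOf 𝒟.toCauchyDevelopment d.charted ∧ Summit.FinalStateConjecture.RaysStayInClosure 𝒟.toCauchyDevelopment O ∧ Summit.FinalStateConjecture.HasExhaustiveCharts d ∧ Summit.FinalStateConjecture.IsFutureOriented d ∧ (∀ i, |d.spin i| ≤ χ * d.mass i ∧ m ≤ d.mass i) ∧ d.N = n; let AdhRobN : ℕ → Literature.Geometry.Lorentzian.InitialDataSet (𝓡 3) X → Prop := fun n d ↦ ∃ χ : ℝ, χ < 1 ∧ ∃ m : ℝ, 0 < m ∧ ∃ (e : Literature.Geometry.Lorentzian.AFEnd X) (F : EuclideanSpace ℝ (Fin 1) → Literature.Geometry.Lorentzian.InitialDataSet (𝓡 3) X), Literature.Geometry.Lorentzian.InitialDataSet.IsTameDataFamily e 1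 F ∧ Literature.Geometry.Lorentzian.InitialDataSet.IsImmersedAtZero 1 F ∧ F 0 = d ∧ (∀ c, F c ∈ Literature.Geometry.Lorentzian.admissibleVacuumData X) ∧ ∃ᶠ c in 𝓝[≠] (0 : EuclideanSpace ℝ (Fin 1)), RobN χ m n (F c); let Jump : Literature.Geometry.Lorentzian.InitialDataSet (𝓡 3) X → Prop := fun d ↦ ∃ n n' : ℕ, n ≠ n' ∧ AdhRobN n d ∧ AdhRobN n' d; ∀ d ∈ Literature.Geometry.Lorentzian.admissibleVacuumData X, ¬ P d → ((AdhRob d ∧ ¬ Adh0 d) ∧ ¬ Jump d) → ∃ (e : Literature.Geometry.Lorentzian.AFEnd X) (F : EuclideanSpace ℝ (Fin 1) → Literature.Geometry.Lorentzian.InitialDataSet (𝓡 3) X), Literature.Geometry.Lorentzian.InitialDataSet.IsTameDataFamily e 1 F ∧ Literature.Geometry.Lorentzian.InitialDataSet.IsImmersedAtZero 1 F ∧ F 0 = d ∧ Injective F ∧ (∀ c, F c ∈ Literature.Geometry.Lorentzian.admissibleVacuumData X) ∧ ∀ c ≠ 0, P (F c)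

-- parent: PureThresholdCurable · child (gen 1)
/--     item stmt-FinalStateConjecture-26732 · crux · rank 201 · open
    parent: PureThresholdCurable · by planner
    why it might fail: A censored non-Kerr stationary or eternally non-settling vacuum exterior whose tame neighbours all settle uniformly robustly but which no tame curve leaves (rigidity without analyticity); or a type-II critical point recaptured by a spectator hole, both sides uniformly robust.
    sources: arXiv:0711.0040, arXiv:0902.1173, arXiv:2305.17171, Christodoulou1999, doi:10.1103/PhysRevLett.70.9, doi:10.1103/PhysRevLett.70.2980
[crux · gen-4 glued split of PureThresholdCurable (stmt-26250), lens-4 g4 node GapGradedThresholds,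
CLEARED[+park-rule] by decomp-fsc-crit-1-g0 2026-08-30T03:28:43Z; child Gapped = cell Pu ∧
UniformGap (∃ χ < 1, m > 0 such that along EVERY admissible tame immersed curve through d the
settling members eventually settle (χ, m)-robustly — window normal form
eventually_window_of_uniformGap: the neighbours' final Kerr parameters precompact in the open
sub-extremal moduli); WEAKER (S ⟹ it, necessity kernel; probe C → S not closed) · NEW RESIDUAL
(rigidity / no-hair with a robust side; recaptured critical collapse at fixed scale; typed-clause
artefacts) · INTERNAL NODE · IDEA-NEEDED[rigidity; U_rate per caution c4] · #h21_crux_probe VERDICT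
CLEAN · PARK RULE (critic, cell-wide from gen 4): this branch may be split again ONLY if the next
cut yields an ATTACKABLE rung (norm-matched per c4) or a thin piece with a registered kill path,
else it is PARKED as typed; writer glue/exactness folder/n4bg4/Sketch.lean rc 0 / 0 sorry; lets
P/P0/Adh0/Rob/AdhRob/RobN/AdhRobN/Jump byte-identical to 26250, one new let Gap] GAPPED PURE
THRESHOLDS ARE CURABLE: through every admissible datum failing P_Σ which -/
@[route_item "route-FinalStateConjecture-RootDecompMultiplicityCells"]
def GappedThresholdCurable : Prop :=
  ∀ (X : Type) [TopologicalSpace X] [ChartedSpace Literature.Geometry.Lorentzian.E3 X] [IsManifold (𝓡 3) ((⊤ : ℕ∞) : WithTop ℕ∞) X] [T2Space X] [SecondCountableTopology X] [ConnectedSpace X], let P : Literature.Geometry.Lorentzian.InitialDataSet (𝓡 3) X → Prop := fun D ↦ (∃ 𝒟 : Literature.Geometry.Lorentzian.VacuumCauchyDevelopment D, 𝒟.IsMaximal) ∧ ∀ 𝒟 : Literature.Geometry.Lorentzian.VacuumCauchyDevelopment D, 𝒟.IsMaximal → Summit.FinalStateConjecture.HasCompleteNullInfinity 𝒟.toCauchyDevelopment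 ∧ ∃ (O : Set 𝒟.carrier) (d : Literature.Geometry.Lorentzian.FinalStateDecomposition 𝒟.toSpacetime O 2), (∀ i, Literature.Geometry.Lorentzian.Kerr.IsSubextremal (d.mass i) (d.spin i)) ∧ O = Summit.FinalStateConjecture.exteriorOf 𝒟.toCauchyDevelopment d.charted ∧ Summit.FinalStateConjecture.RaysStayInClosure 𝒟.toCauchyDevelopment O ∧ Summit.FinalStateConjecture.HasExhaustiveCharts d ∧ Summit.FinalStateConjecture.IsFutureOriented d; let P0 : Literature.Geometry.Lorentzian.InitialDataSet (𝓡 3) X → Prop := fun D ↦ (∃ 𝒟 : Literature.Geometry.Lorentzian.VacuumCauchyDevelopment D, 𝒟.IsMaximal) ∧ ∀ 𝒟 : Literature.Geometry.Lorentzian.VacuumCauchyDevelopment D, 𝒟.IsMaximal → Summit.FinalStateConjecture.HasCompleteNullInfinity 𝒟.toCauchyDevelopment ∧ ∃ (O : Set 𝒟.carrier) (d : Literature.Geometry.Lorentzian.FinalStateDecomposition 𝒟.toSpacetime O 2), d.N = 0 ∧ (∀ i, Literature.Geometry.Lorentzian.Kerr.IsSubextremal (d.mass i) (d.spin i)) ∧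 O = Summit.FinalStateConjecture.exteriorOf 𝒟.toCauchyDevelopment d.charted ∧ Summit.FinalStateConjecture.RaysStayInClosure 𝒟.toCauchyDevelopment O ∧ Summit.FinalStateConjecture.HasExhaustiveCharts d ∧ Summit.FinalStateConjecture.IsFutureOriented d; let Adh0 : Literature.Geometry.Lorentzian.InitialDataSet (𝓡 3) X → Prop := fun d ↦ ∃ (e : Literature.Geometry.Lorentzian.AFEnd X) (F : EuclideanSpace ℝ (Fin 1) → Literature.Geometry.Lorentzian.InitialDataSet (𝓡 3) X), Literature.Geometry.Lorentzian.InitialDataSet.IsTameDataFamily e 1 F ∧ Literature.Geometry.Lorentzian.InitialDataSet.IsImmersedAtZero 1 F ∧ F 0 = d ∧ (∀ c, F c ∈ Literature.Geometry.Lorentzian.admissibleVacuumData X) ∧ ∃ᶠ c in 𝓝[≠] (0 : EuclideanSpace ℝ (Fin 1)), P0 (F c); let Rob : ℝ → ℝ → Literature.Geometry.Lorentzian.InitialDataSet (𝓡 3) X → Prop := fun χ m D ↦ P D ∧ ∃ 𝒟 : Literature.Geometry.Lorentzian.VacuumCauchyDevelopment D, 𝒟.IsMaximal ∧ ∃ (O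 : Set 𝒟.carrier) (d : Literature.Geometry.Lorentzian.FinalStateDecomposition 𝒟.toSpacetime O 2), (∀ i, Literature.Geometry.Lorentzian.Kerr.IsSubextremal (d.mass i) (d.spin i)) ∧ O = Summit.FinalStateConjecture.exteriorOf 𝒟.toCauchyDevelopment d.charted ∧ Summit.FinalStateConjecture.RaysStayInClosure 𝒟.toCauchyDevelopment O ∧ Summit.FinalStateConjecture.HasExhaustiveCharts d ∧ Summit.FinalStateConjecture.IsFutureOriented d ∧ ∀ i, |d.spin i| ≤ χ * d.mass i ∧ m ≤ d.mass i; let AdhRob : Literature.Geometry.Lorentzian.InitialDataSet (𝓡 3) X → Prop := fun d ↦ ∃ χ : ℝ, χ < 1 ∧ ∃ m : ℝ, 0 < m ∧ ∃ (e : Literature.Geometry.Lorentzian.AFEnd X) (F : EuclideanSpace ℝ (Fin 1) → Literature.Geometry.Lorentzian.InitialDataSet (𝓡 3) X), Literature.Geometry.Lorentzian.InitialDataSet.IsTameDataFamily e 1 F ∧ Literature.Geometry.Lorentzian.InitialDataSet.IsImmersedAtZero 1 F ∧ F 0 = d ∧ (∀ c, F c ∈ Literature.Geometry.Lorentzian.admissibleVacuumData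 X) ∧ ∃ᶠ c in 𝓝[≠] (0 : EuclideanSpace ℝ (Fin 1)), Rob χ m (F c); let RobN : ℝ → ℝ → ℕ → Literature.Geometry.Lorentzian.InitialDataSet (𝓡 3) X → Prop := fun χ m n D ↦ P D ∧ ∃ 𝒟 : Literature.Geometry.Lorentzian.VacuumCauchyDevelopment D, 𝒟.IsMaximal ∧ ∃ (O : Set 𝒟.carrier) (d : Literature.Geometry.Lorentzian.FinalStateDecomposition 𝒟.toSpacetime O 2), (∀ i, Literature.Geometry.Lorentzian.Kerr.IsSubextremal (d.mass i) (d.spin i)) ∧ O = Summit.FinalStateConjecture.exteriorOf 𝒟.toCauchyDevelopment d.charted ∧ Summit.FinalStateConjecture.RaysStayInClosure 𝒟.toCauchyDevelopment O ∧ Summit.FinalStateConjecture.HasExhaustiveCharts d ∧ Summit.FinalStateConjecture.IsFutureOriented d ∧ (∀ i, |d.spin i| ≤ χ * d.mass i ∧ m ≤ d.mass i) ∧ d.N = n; let AdhRobN : ℕ → Literature.Geometry.Lorentzian.InitialDataSet (𝓡 3) X → Prop := fun n d ↦ ∃ χ : ℝ, χ < 1 ∧ ∃ m : ℝ, 0 <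 m ∧ ∃ (e : Literature.Geometry.Lorentzian.AFEnd X) (F : EuclideanSpace ℝ (Fin 1) → Literature.Geometry.Lorentzian.InitialDataSet (𝓡 3) X), Literature.Geometry.Lorentzian.InitialDataSet.IsTameDataFamily e 1 F ∧ Literature.Geometry.Lorentzian.InitialDataSet.IsImmersedAtZero 1 F ∧ F 0 = d ∧ (∀ c, F c ∈ Literature.Geometry.Lorentzian.admissibleVacuumData X) ∧ ∃ᶠ c in 𝓝[≠] (0 : EuclideanSpace ℝ (Fin 1)), RobN χ m n (F c); let Jump : Literature.Geometry.Lorentzian.InitialDataSet (𝓡 3) X → Prop := fun d ↦ ∃ n n' : ℕ, n ≠ n' ∧ AdhRobN n d ∧ AdhRobN n' d; let Gap : Literature.Geometry.Lorentzian.InitialDataSet (𝓡 3) X → Prop := fun d ↦ ∃ χ : ℝ, χ < 1 ∧ ∃ m : ℝ, 0 < m ∧ ∀ (e : Literature.Geometry.Lorentzian.AFEnd X) (F : EuclideanSpace ℝ (Fin 1) → Literature.Geometry.Lorentzian.InitialDataSet (𝓡 3) X), Literature.Geometry.Lorentzian.InitialDataSet.IsTameDataFamily e 1 F → Literature.Geometry.Lorentzian.InitialDataSet.IsImmersedAtZero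 1 F → F 0 = d → (∀ c, F c ∈ Literature.Geometry.Lorentzian.admissibleVacuumData X) → ∀ᶠ c in 𝓝[≠] (0 : EuclideanSpace ℝ (Fin 1)), P (F c) → Rob χ m (F c); ∀ d ∈ Literature.Geometry.Lorentzian.admissibleVacuumData X, ¬ P d → (((AdhRob d ∧ ¬ Adh0 d) ∧ ¬ Jump d) ∧ Gap d) → ∃ (e : Literature.Geometry.Lorentzian.AFEnd X) (F : EuclideanSpace ℝ (Fin 1) → Literature.Geometry.Lorentzian.InitialDataSet (𝓡 3) X), Literature.Geometry.Lorentzian.InitialDataSet.IsTameDataFamily e 1 F ∧ Literature.Geometry.Lorentzian.InitialDataSet.IsImmersedAtZero 1 F ∧ F 0 = d ∧ Injective F ∧ (∀ c, F c ∈ Literature.Geometry.Lorentzian.admissibleVacuumData X) ∧ ∀ c ≠ 0, P (F c)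

-- parent: PureThresholdCurable · child (gen 1)
/--     item stmt-FinalStateConjecture-26733 · crux · rank 202 · open
    parent: PureThresholdCurable · by planner
    why it might fail: Generic naked-singularity formation at a critical point inside a robust collapse environment whose collapsing neighbours accumulate only on laminated parameter sets (non-universal vacuum critical collapse); or an isolated extremal-Kerr-forming datum, Aretakis-unstable along every tame curve.
    sources: Christodoulou1999, arXiv:2402.10190, arXiv:2211.15742, arXiv:2305.17171, arXiv:1110.2007, doi:10.1103/PhysRevLett.70.9
[crux · gen-4 glued split of PureThresholdCurable (stmt-26250), lens-4 g4 node GapGradedThresholds,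
CLEARED[+park-rule] 2026-08-30T03:28:43Z; child Soft = cell Pu ∧ ¬ UniformGap — equivalently (kernel
light_or_extreme_of_not_uniformGap, exhaustive) in every window soft settlers adhere: VANISHING
stratum (black holes of arbitrarily small mass form arbitrarily close: type-II critical collapse
beside spectators, M_BH ∼ (p − p*)^γ) ∨ DEGENERATION stratum (final pieces of spin ratio arbitrarily
close to 1 form arbitrarily close: extremal walls with a robust side); WEAKER · INTERNAL NODE ·
INSTRUMENTABLE (census K1–K3) + IDEA-NEEDED · BARRIER-PLACED (vanishing: nakedSingularityInstability
is the MODEL of the cure but outside its printed spherical-scalar scope; degeneration: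
AretakisInstability inside, Kehle–Unger Conj. 5 population, existence away from cell I UNDECIDED =
K2) · VERDICT CLEAN · PARK RULE applies (see Gapped); the two strata are typed in the lens kernel,
NOT filed; one-end data-class caveat on every NR membership sentence; glue Gapped → Soft → Pu proved
(folder/n4bg4/Sketch.lean)] SOFT PURE THRESHOLDS ARE CURABLE: through every admissible datum failing
P_Σ which is a tame l -/
@[route_item "route-FinalStateConjecture-RootDecompMultiplicityCells"]
def SoftThresholdCurable : Prop :=
  ∀ (X : Type) [TopologicalSpace X] [ChartedSpace Literature.Geometry.Lorentzian.E3 X] [IsManifold (𝓡 3) ((⊤ : ℕ∞) : WithTop ℕ∞) X] [T2Space X] [SecondCountableTopology X] [ConnectedSpace X], let P : Literature.Geometry.Lorentzian.InitialDataSet (𝓡 3) X → Prop := fun D ↦ (∃ 𝒟 : Literature.Geometry.Lorentzian.VacuumCauchyDevelopment D, 𝒟.IsMaximal) ∧ ∀ 𝒟 : Literature.Geometry.Lorentzian.VacuumCauchyDevelopment D, 𝒟.IsMaximal → Summit.FinalStateConjecture.HasCompleteNullInfinity 𝒟.toCauchyDevelopment ∧ ∃ (O : Set 𝒟.carrier)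 (d : Literature.Geometry.Lorentzian.FinalStateDecomposition 𝒟.toSpacetime O 2), (∀ i, Literature.Geometry.Lorentzian.Kerr.IsSubextremal (d.mass i) (d.spin i)) ∧ O = Summit.FinalStateConjecture.exteriorOf 𝒟.toCauchyDevelopment d.charted ∧ Summit.FinalStateConjecture.RaysStayInClosure 𝒟.toCauchyDevelopment O ∧ Summit.FinalStateConjecture.HasExhaustiveCharts d ∧ Summit.FinalStateConjecture.IsFutureOriented d; let P0 : Literature.Geometry.Lorentzian.InitialDataSet (𝓡 3) X → Prop := fun D ↦ (∃ 𝒟 : Literature.Geometry.Lorentzian.VacuumCauchyDevelopment D, 𝒟.IsMaximal) ∧ ∀ 𝒟 : Literature.Geometry.Lorentzian.VacuumCauchyDevelopment D, 𝒟.IsMaximal → Summit.FinalStateConjecture.HasCompleteNullInfinity 𝒟.toCauchyDevelopment ∧ ∃ (O : Set 𝒟.carrier) (d : Literature.Geometry.Lorentzian.FinalStateDecomposition 𝒟.toSpacetime O 2), d.N = 0 ∧ (∀ i, Literature.Geometry.Lorentzian.Kerr.IsSubextremal (d.mass i) (d.spin i)) ∧ O = Summit.FinalStateConjecture.exteriorOf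 𝒟.toCauchyDevelopment d.charted ∧ Summit.FinalStateConjecture.RaysStayInClosure 𝒟.toCauchyDevelopment O ∧ Summit.FinalStateConjecture.HasExhaustiveCharts d ∧ Summit.FinalStateConjecture.IsFutureOriented d; let Adh0 : Literature.Geometry.Lorentzian.InitialDataSet (𝓡 3) X → Prop := fun d ↦ ∃ (e : Literature.Geometry.Lorentzian.AFEnd X) (F : EuclideanSpace ℝ (Fin 1) → Literature.Geometry.Lorentzian.InitialDataSet (𝓡 3) X), Literature.Geometry.Lorentzian.InitialDataSet.IsTameDataFamily e 1 F ∧ Literature.Geometry.Lorentzian.InitialDataSet.IsImmersedAtZero 1 F ∧ F 0 = d ∧ (∀ c, F c ∈ Literature.Geometry.Lorentzian.admissibleVacuumData X) ∧ ∃ᶠ c in 𝓝[≠] (0 : EuclideanSpace ℝ (Fin 1)), P0 (F c); let Rob : ℝ → ℝ → Literature.Geometry.Lorentzian.InitialDataSet (𝓡 3) X → Prop := fun χ m D ↦ P D ∧ ∃ 𝒟 : Literature.Geometry.Lorentzian.VacuumCauchyDevelopment D, 𝒟.IsMaximal ∧ ∃ (O : Set 𝒟.carrier) (d : Literature.Geometry.Lorentzian.FinalStateDecomposition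 𝒟.toSpacetime O 2), (∀ i, Literature.Geometry.Lorentzian.Kerr.IsSubextremal (d.mass i) (d.spin i)) ∧ O = Summit.FinalStateConjecture.exteriorOf 𝒟.toCauchyDevelopment d.charted ∧ Summit.FinalStateConjecture.RaysStayInClosure 𝒟.toCauchyDevelopment O ∧ Summit.FinalStateConjecture.HasExhaustiveCharts d ∧ Summit.FinalStateConjecture.IsFutureOriented d ∧ ∀ i, |d.spin i| ≤ χ * d.mass i ∧ m ≤ d.mass i; let AdhRob : Literature.Geometry.Lorentzian.InitialDataSet (𝓡 3) X → Prop := fun d ↦ ∃ χ : ℝ, χ < 1 ∧ ∃ m : ℝ, 0 < m ∧ ∃ (e : Literature.Geometry.Lorentzian.AFEnd X) (F : EuclideanSpace ℝ (Fin 1) → Literature.Geometry.Lorentzian.InitialDataSet (𝓡 3) X), Literature.Geometry.Lorentzian.InitialDataSet.IsTameDataFamily e 1 F ∧ Literature.Geometry.Lorentzian.InitialDataSet.IsImmersedAtZero 1 F ∧ F 0 = d ∧ (∀ c, F c ∈ Literature.Geometry.Lorentzian.admissibleVacuumData X) ∧ ∃ᶠ c in 𝓝[≠] (0 : EuclideanSpace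 ℝ (Fin 1)), Rob χ m (F c); let RobN : ℝ → ℝ → ℕ → Literature.Geometry.Lorentzian.InitialDataSet (𝓡 3) X → Prop := fun χ m n D ↦ P D ∧ ∃ 𝒟 : Literature.Geometry.Lorentzian.VacuumCauchyDevelopment D, 𝒟.IsMaximal ∧ ∃ (O : Set 𝒟.carrier) (d : Literature.Geometry.Lorentzian.FinalStateDecomposition 𝒟.toSpacetime O 2), (∀ i, Literature.Geometry.Lorentzian.Kerr.IsSubextremal (d.mass i) (d.spin i)) ∧ O = Summit.FinalStateConjecture.exteriorOf 𝒟.toCauchyDevelopment d.charted ∧ Summit.FinalStateConjecture.RaysStayInClosure 𝒟.toCauchyDevelopment O ∧ Summit.FinalStateConjecture.HasExhaustiveCharts d ∧ Summit.FinalStateConjecture.IsFutureOriented d ∧ (∀ i, |d.spin i| ≤ χ * d.mass i ∧ m ≤ d.mass i) ∧ d.N = n; let AdhRobN : ℕ → Literature.Geometry.Lorentzian.InitialDataSet (𝓡 3) X → Prop := fun n d ↦ ∃ χ : ℝ, χ < 1 ∧ ∃ m : ℝ, 0 < m ∧ ∃ (e : Literature.Geometry.Lorentzian.AFEnd X) (F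 : EuclideanSpace ℝ (Fin 1) → Literature.Geometry.Lorentzian.InitialDataSet (𝓡 3) X), Literature.Geometry.Lorentzian.InitialDataSet.IsTameDataFamily e 1 F ∧ Literature.Geometry.Lorentzian.InitialDataSet.IsImmersedAtZero 1 F ∧ F 0 = d ∧ (∀ c, F c ∈ Literature.Geometry.Lorentzian.admissibleVacuumData X) ∧ ∃ᶠ c in 𝓝[≠] (0 : EuclideanSpace ℝ (Fin 1)), RobN χ m n (F c); let Jump : Literature.Geometry.Lorentzian.InitialDataSet (𝓡 3) X → Prop := fun d ↦ ∃ n n' : ℕ, n ≠ n' ∧ AdhRobN n d ∧ AdhRobN n' d; let Gap : Literature.Geometry.Lorentzian.InitialDataSet (𝓡 3) X → Prop := fun d ↦ ∃ χ : ℝ, χ < 1 ∧ ∃ m : ℝ, 0 < m ∧ ∀ (e : Literature.Geometry.Lorentzian.AFEnd X) (F : EuclideanSpace ℝ (Fin 1) → Literature.Geometry.Lorentzian.InitialDataSet (𝓡 3) X), Literature.Geometry.Lorentzian.InitialDataSet.IsTameDataFamily e 1 F → Literature.Geometry.Lorentzian.InitialDataSet.IsImmersedAtZero 1 F → F 0 =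 d → (∀ c, F c ∈ Literature.Geometry.Lorentzian.admissibleVacuumData X) → ∀ᶠ c in 𝓝[≠] (0 : EuclideanSpace ℝ (Fin 1)), P (F c) → Rob χ m (F c); ∀ d ∈ Literature.Geometry.Lorentzian.admissibleVacuumData X, ¬ P d → (((AdhRob d ∧ ¬ Adh0 d) ∧ ¬ Jump d) ∧ ¬ Gap d) → ∃ (e : Literature.Geometry.Lorentzian.AFEnd X) (F : EuclideanSpace ℝ (Fin 1) → Literature.Geometry.Lorentzian.InitialDataSet (𝓡 3) X), Literature.Geometry.Lorentzian.InitialDataSet.IsTameDataFamily e 1 F ∧ Literature.Geometry.Lorentzian.InitialDataSet.IsImmersedAtZero 1 F ∧ F 0 = d ∧ Injective F ∧ (∀ c, F c ∈ Literature.Geometry.Lorentzian.admissibleVacuumData X) ∧ ∀ c ≠ 0, P (F c)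

-- parent: PureThresholdCurable · glue (gen 1)
/--     item stmt-FinalStateConjecture-26734 · support · rank 203 · open
    parent: PureThresholdCurable · GLUE: children ⟹ parent · by planner
GappedThresholdCurable → SoftThresholdCurable → PureThresholdCurable -/
@[route_item "route-FinalStateConjecture-RootDecompMultiplicityCells"]
def PureThresholdCurableGlue : Prop :=
  GappedThresholdCurable → SoftThresholdCurable → PureThresholdCurable

/-- item stmt-FinalStateConjecture-26251 · crux · rank 3 · open · by planner
why it might fail: an eternal vacuum few-black-hole scattering-threshold solution (three-body / hyperbolic analogue of the Alekseev–Moser capture Cantor set, arXiv:gr-qc/9910040) surviving radiation reaction, its two robust multiplicities interlacing along every tame curve — no cure.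
sources: arXiv:gr-qc/0702084, arXiv:1207.5167, arXiv:1310.4209, arXiv:gr-qc/9910040, isbn:9780691089102
[crux] PIECE Sc — gen-3 lens-4 MultiplicityGradedThresholds child Sc of the residual R =
RobustThresholdCurable (stmt-FinalStateConjecture-25216, which stays on the parent route as the
exact conjunction Sc ∧ Pu, kernel split_iff) [WEAKER·thin·INSTRUMENTABLE + IDEA-NEEDED — critic
CLEARED 2026-08-30T02:55:40Z: COUNTS-as-thin; first piece in the cell with a REGISTERED negative
route against it (stmt-16893 ∧ stmt-16894)]: SCATTERING THRESHOLDS (MULTIPLICITY JUMPS) ARE CURABLE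
— for every Σ, through every admissible datum failing P_Σ which is a tame limit of robustly settling
data (AdhRob), not a tame limit of dispersing data (¬Adh0), and at which robust phases of TWO
DIFFERENT final multiplicities n ≠ n' are adjacent (Jump: AdhRobN n ∧ AdhRobN n'), passes a tame
(order 1 at one end), immersed-at-0, injective admissible curve all of whose members off 0 satisfy
P_Σ. = the ORBITAL few-body sector (scattering / capture / ejection thresholds); kernel
exists_two_multiplicities_of_jump, jump_of_interlaced
(HOME/decomp-fsc-lens-4/MultiplicityGradedThresholds.lean). Kill path BY NAME:
stmt-FinalStateConjecture-16893 LaminatedThreshold ∧ stmt-16894 TameExitsLocalise at a jump datum.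
Lets P / P0 -/
@[route_item "route-FinalStateConjecture-RootDecompMultiplicityCells", crux]
def ScatteringThresholdCurable : Prop :=
  ∀ (X : Type) [TopologicalSpace X] [ChartedSpace Literature.Geometry.Lorentzian.E3 X] [IsManifold (𝓡 3) ((⊤ : ℕ∞) : WithTop ℕ∞) X] [T2Space X] [SecondCountableTopology X] [ConnectedSpace X], let P : Literature.Geometry.Lorentzian.InitialDataSet (𝓡 3) X → Prop := fun D ↦ (∃ 𝒟 : Literature.Geometry.Lorentzian.VacuumCauchyDevelopment D, 𝒟.IsMaximal) ∧ ∀ 𝒟 : Literature.Geometry.Lorentzian.VacuumCauchyDevelopment D, 𝒟.IsMaximal → Summit.FinalStateConjecture.HasCompleteNullInfinity 𝒟.toCauchyDevelopment ∧ ∃ (O : Set 𝒟.carrier) (d : Literature.Geometry.Lorentzian.FinalStateDecomposition 𝒟.toSpacetime O 2), (∀ i, Literature.Geometry.Lorentzian.Kerr.IsSubextremal (d.mass i) (d.spin i)) ∧ O = Summit.FinalStateConjecture.exteriorOf 𝒟.toCauchyDevelopment d.charted ∧ Summit.FinalStateConjecture.RaysStayInClosure 𝒟.toCauchyDevelopment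 O ∧ Summit.FinalStateConjecture.HasExhaustiveCharts d ∧ Summit.FinalStateConjecture.IsFutureOriented d; let P0 : Literature.Geometry.Lorentzian.InitialDataSet (𝓡 3) X → Prop := fun D ↦ (∃ 𝒟 : Literature.Geometry.Lorentzian.VacuumCauchyDevelopment D, 𝒟.IsMaximal) ∧ ∀ 𝒟 : Literature.Geometry.Lorentzian.VacuumCauchyDevelopment D, 𝒟.IsMaximal → Summit.FinalStateConjecture.HasCompleteNullInfinity 𝒟.toCauchyDevelopment ∧ ∃ (O : Set 𝒟.carrier) (d : Literature.Geometry.Lorentzian.FinalStateDecomposition 𝒟.toSpacetime O 2), d.N = 0 ∧ (∀ i, Literature.Geometry.Lorentzian.Kerr.IsSubextremal (d.mass i) (d.spin i)) ∧ O = Summit.FinalStateConjecture.exteriorOf 𝒟.toCauchyDevelopment d.charted ∧ Summit.FinalStateConjecture.RaysStayInClosure 𝒟.toCauchyDevelopment O ∧ Summit.FinalStateConjecture.HasExhaustiveCharts d ∧ Summit.FinalStateConjecture.IsFutureOriented d; let Adh0 : Literature.Geometry.Lorentzian.InitialDataSet (𝓡 3) X → Prop := fun d ↦ ∃ (e : Literature.Geometry.Lorentzian.AFEnd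 X) (F : EuclideanSpace ℝ (Fin 1) → Literature.Geometry.Lorentzian.InitialDataSet (𝓡 3) X), Literature.Geometry.Lorentzian.InitialDataSet.IsTameDataFamily e 1 F ∧ Literature.Geometry.Lorentzian.InitialDataSet.IsImmersedAtZero 1 F ∧ F 0 = d ∧ (∀ c, F c ∈ Literature.Geometry.Lorentzian.admissibleVacuumData X) ∧ ∃ᶠ c in 𝓝[≠] (0 : EuclideanSpace ℝ (Fin 1)), P0 (F c); let Rob : ℝ → ℝ → Literature.Geometry.Lorentzian.InitialDataSet (𝓡 3) X → Prop := fun χ m D ↦ P D ∧ ∃ 𝒟 : Literature.Geometry.Lorentzian.VacuumCauchyDevelopment D, 𝒟.IsMaximal ∧ ∃ (O : Set 𝒟.carrier) (d : Literature.Geometry.Lorentzian.FinalStateDecomposition 𝒟.toSpacetime O 2), (∀ i, Literature.Geometry.Lorentzian.Kerr.IsSubextremal (d.mass i) (d.spin i)) ∧ O = Summit.FinalStateConjecture.exteriorOf 𝒟.toCauchyDevelopment d.charted ∧ Summit.FinalStateConjecture.RaysStayInClosure 𝒟.toCauchyDevelopment O ∧ Summit.FinalStateConjecture.HasExhaustiveCharts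 d ∧ Summit.FinalStateConjecture.IsFutureOriented d ∧ ∀ i, |d.spin i| ≤ χ * d.mass i ∧ m ≤ d.mass i; let AdhRob : Literature.Geometry.Lorentzian.InitialDataSet (𝓡 3) X → Prop := fun d ↦ ∃ χ : ℝ, χ < 1 ∧ ∃ m : ℝ, 0 < m ∧ ∃ (e : Literature.Geometry.Lorentzian.AFEnd X) (F : EuclideanSpace ℝ (Fin 1) → Literature.Geometry.Lorentzian.InitialDataSet (𝓡 3) X), Literature.Geometry.Lorentzian.InitialDataSet.IsTameDataFamily e 1 F ∧ Literature.Geometry.Lorentzian.InitialDataSet.IsImmersedAtZero 1 F ∧ F 0 = d ∧ (∀ c, F c ∈ Literature.Geometry.Lorentzian.admissibleVacuumData X) ∧ ∃ᶠ c in 𝓝[≠] (0 : EuclideanSpace ℝ (Fin 1)), Rob χ m (F c); let RobN : ℝ → ℝ → ℕ → Literature.Geometry.Lorentzian.InitialDataSet (𝓡 3) X → Prop := fun χ m n D ↦ P D ∧ ∃ 𝒟 : Literature.Geometry.Lorentzian.VacuumCauchyDevelopment D, 𝒟.IsMaximal ∧ ∃ (O : Set 𝒟.carrier) (d : Literature.Geometry.Lorentzian.FinalStateDecomposition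 𝒟.toSpacetime O 2), (∀ i, Literature.Geometry.Lorentzian.Kerr.IsSubextremal (d.mass i) (d.spin i)) ∧ O = Summit.FinalStateConjecture.exteriorOf 𝒟.toCauchyDevelopment d.charted ∧ Summit.FinalStateConjecture.RaysStayInClosure 𝒟.toCauchyDevelopment O ∧ Summit.FinalStateConjecture.HasExhaustiveCharts d ∧ Summit.FinalStateConjecture.IsFutureOriented d ∧ (∀ i, |d.spin i| ≤ χ * d.mass i ∧ m ≤ d.mass i) ∧ d.N = n; let AdhRobN : ℕ → Literature.Geometry.Lorentzian.InitialDataSet (𝓡 3) X → Prop := fun n d ↦ ∃ χ : ℝ, χ < 1 ∧ ∃ m : ℝ, 0 < m ∧ ∃ (e : Literature.Geometry.Lorentzian.AFEnd X) (F : EuclideanSpace ℝ (Fin 1) → Literature.Geometry.Lorentzian.InitialDataSet (𝓡 3) X), Literature.Geometry.Lorentzian.InitialDataSet.IsTameDataFamily e 1 F ∧ Literature.Geometry.Lorentzian.InitialDataSet.IsImmersedAtZero 1 F ∧ F 0 = d ∧ (∀ c, F c ∈ Literature.Geometry.Lorentzian.admissibleVacuumData X) ∧ ∃ᶠ c in 𝓝[≠]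 (0 : EuclideanSpace ℝ (Fin 1)), RobN χ m n (F c); let Jump : Literature.Geometry.Lorentzian.InitialDataSet (𝓡 3) X → Prop := fun d ↦ ∃ n n' : ℕ, n ≠ n' ∧ AdhRobN n d ∧ AdhRobN n' d; ∀ d ∈ Literature.Geometry.Lorentzian.admissibleVacuumData X, ¬ P d → ((AdhRob d ∧ ¬ Adh0 d) ∧ Jump d) → ∃ (e : Literature.Geometry.Lorentzian.AFEnd X) (F : EuclideanSpace ℝ (Fin 1) → Literature.Geometry.Lorentzian.InitialDataSet (𝓡 3) X), Literature.Geometry.Lorentzian.InitialDataSet.IsTameDataFamily e 1 F ∧ Literature.Geometry.Lorentzian.InitialDataSet.IsImmersedAtZero 1 F ∧ F 0 = d ∧ Injective F ∧ (∀ c, F c ∈ Literature.Geometry.Lorentzian.admissibleVacuumData X) ∧ ∀ c ≠ 0, P (F c)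

/-- item stmt-FinalStateConjecture-25217 · crux · rank 4 · open · by planner
why it might fail: at a vacuum extremal wall not adjacent to dispersion (third-law / overspinning threshold) the only settling neighbours are near-extremal and the Aretakis instability may make the settling side fail to be one-sidedly tame-open, leaving no punctured curve of settling data.
sources: arXiv:2402.10190, arXiv:2601.20955, arXiv:1110.2007, arXiv:2211.15742
[crux · gen-2 glued split of SettlingAdherentCurable (stmt-24910), lens-4 g2; WEAKER·thin·BARRIER
(AretakisInstability declared inside); leaf IDEA-NEEDED + INSTRUMENTABLE (census T-X1 max remnant
spin in one-ended vacuum collapse; T-X2 EMCSF extremal leaves); registered statement in its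
direction stmt-FinalStateConjecture-10606 PhaseMixingCapture.NearExtremalKappaCapture cited by name;
lens kernel certificates exists_nearExtremal_remnant_of_adhMacro, not_adhMacro_of_gap] For every Σ
and every admissible P_Σ-exceptional datum d which is a tame limit of settling admissible data but
of NO robust class G_(χ,m) (χ < 1, m > 0) — along every admissible tame curve through d the settling
members' remnants extremalise (|aᵢ|/Mᵢ → 1) or evanesce (Mᵢ → 0) — there are one end e and a tame
immersed injective admissible one-parameter family F with F 0 = d whose members c ≠ 0 satisfy P_Σ. -/
@[route_item "route-FinalStateConjecture-RootDecompMultiplicityCells", crux]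
def DegenerateThresholdCurable : Prop :=
  ∀ (X : Type) [TopologicalSpace X] [ChartedSpace Literature.Geometry.Lorentzian.E3 X] [IsManifold (𝓡 3) ((⊤ : ℕ∞) : WithTop ℕ∞) X] [T2Space X] [SecondCountableTopology X] [ConnectedSpace X], let P : Literature.Geometry.Lorentzian.InitialDataSet (𝓡 3) X → Prop := fun D ↦ (∃ 𝒟 : Literature.Geometry.Lorentzian.VacuumCauchyDevelopment D, 𝒟.IsMaximal) ∧ ∀ 𝒟 : Literature.Geometry.Lorentzian.VacuumCauchyDevelopment D, 𝒟.IsMaximal → Summit.FinalStateConjecture.HasCompleteNullInfinity 𝒟.toCauchyDevelopment ∧ ∃ (O : Set 𝒟.carrier) (d : Literature.Geometry.Lorentzian.FinalStateDecomposition 𝒟.toSpacetime O 2), (∀ i, Literature.Geometry.Lorentzian.Kerr.IsSubextremal (d.mass i) (d.spin i)) ∧ O = Summit.FinalStateConjecture.exteriorOf 𝒟.toCauchyDevelopment d.charted ∧ Summit.FinalStateConjecture.RaysStayInClosure 𝒟.toCauchyDevelopment O ∧ Summit.FinalStateConjecture.HasExhaustiveCharts d ∧ Summit.FinalStateConjecture.IsFutureOriented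 d; let AdhP : Literature.Geometry.Lorentzian.InitialDataSet (𝓡 3) X → Prop := fun d ↦ ∃ (e : Literature.Geometry.Lorentzian.AFEnd X) (F : EuclideanSpace ℝ (Fin 1) → Literature.Geometry.Lorentzian.InitialDataSet (𝓡 3) X), Literature.Geometry.Lorentzian.InitialDataSet.IsTameDataFamily e 1 F ∧ Literature.Geometry.Lorentzian.InitialDataSet.IsImmersedAtZero 1 F ∧ F 0 = d ∧ (∀ c, F c ∈ Literature.Geometry.Lorentzian.admissibleVacuumData X) ∧ ∃ᶠ c in 𝓝[≠] (0 : EuclideanSpace ℝ (Fin 1)), P (F c); let Rob : ℝ → ℝ → Literature.Geometry.Lorentzian.InitialDataSet (𝓡 3) X → Prop := fun χ m D ↦ P D ∧ ∃ 𝒟 : Literature.Geometry.Lorentzian.VacuumCauchyDevelopment D, 𝒟.IsMaximal ∧ ∃ (O : Set 𝒟.carrier) (d : Literature.Geometry.Lorentzian.FinalStateDecomposition 𝒟.toSpacetime O 2), (∀ i, Literature.Geometry.Lorentzian.Kerr.IsSubextremal (d.mass i) (d.spin i)) ∧ O = Summit.FinalStateConjecture.exteriorOf 𝒟.toCauchyDevelopment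 d.charted ∧ Summit.FinalStateConjecture.RaysStayInClosure 𝒟.toCauchyDevelopment O ∧ Summit.FinalStateConjecture.HasExhaustiveCharts d ∧ Summit.FinalStateConjecture.IsFutureOriented d ∧ ∀ i, |d.spin i| ≤ χ * d.mass i ∧ m ≤ d.mass i; let AdhRob : Literature.Geometry.Lorentzian.InitialDataSet (𝓡 3) X → Prop := fun d ↦ ∃ χ : ℝ, χ < 1 ∧ ∃ m : ℝ, 0 < m ∧ ∃ (e : Literature.Geometry.Lorentzian.AFEnd X) (F : EuclideanSpace ℝ (Fin 1) → Literature.Geometry.Lorentzian.InitialDataSet (𝓡 3) X), Literature.Geometry.Lorentzian.InitialDataSet.IsTameDataFamily e 1 F ∧ Literature.Geometry.Lorentzian.InitialDataSet.IsImmersedAtZero 1 F ∧ F 0 = d ∧ (∀ c, F c ∈ Literature.Geometry.Lorentzian.admissibleVacuumData X) ∧ ∃ᶠ c in 𝓝[≠] (0 : EuclideanSpace ℝ (Fin 1)), Rob χ m (F c); ∀ d ∈ Literature.Geometry.Lorentzian.admissibleVacuumData X, ¬ P d → (AdhP d ∧ ¬ AdhRob d) → ∃ (e : Literature.Geometry.Lorentzian.AFEnd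 X) (F : EuclideanSpace ℝ (Fin 1) → Literature.Geometry.Lorentzian.InitialDataSet (𝓡 3) X), Literature.Geometry.Lorentzian.InitialDataSet.IsTameDataFamily e 1 F ∧ Literature.Geometry.Lorentzian.InitialDataSet.IsImmersedAtZero 1 F ∧ F 0 = d ∧ Injective F ∧ (∀ c, F c ∈ Literature.Geometry.Lorentzian.admissibleVacuumData X) ∧ ∀ c ≠ 0, P (F c)

/-- item stmt-FinalStateConjecture-24909 · crux · rank 5 · open · by planner
why it might fail: a laminated / fractal vacuum collapse threshold (non-universal critical behaviour) leaves a two-sided accumulating exceptional stratum at a critical datum which no immersed tame curve escapes (route LaminatedThreshold crux A).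
sources: arXiv:0711.4620, arXiv:2108.13379, arXiv:2402.10190, Christodoulou1999
[crux] PIECE I — DispersiveThresholdCurable [WEAKER·thin — critic CLEARED 2026-08-30T01:32:59Z; leaf
IDEA-NEEDED + INSTRUMENTABLE (NR test: regularity of the vacuum collapse threshold in 2-parameter
Brill/Teukolsky-wave families, 50–150 core-h, unrun); road SmoothDispersiveThreshold → piece (lens
kernel `dispersiveThresholdCurable_of_smooth` via the bending lemma `cellEsc_of_graphAccess`)
UNDECIDED, outside closes]. For every Σ and every admissible P_Σ-exceptional datum d which is tamely
adherent to the DISPERSING data (some tame immersed curve of admissible data based at d carries, at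
parameters accumulating at 0, data all of whose MGHDs have complete 𝓘⁺ and an honest decomposition
with N = 0 final holes and the Statement's clauses), there are one end e and a tame immersed
injective one-parameter family F of admissible data with F 0 = d whose members c ≠ 0 satisfy P_Σ.
[difficulty: open-problem] -/
@[route_item "route-FinalStateConjecture-RootDecompMultiplicityCells", crux]
def DispersiveThresholdCurable : Prop :=
  ∀ (X : Type) [TopologicalSpace X] [ChartedSpace Literature.Geometry.Lorentzian.E3 X] [IsManifold (𝓡 3) ((⊤ : ℕ∞) : WithTop ℕ∞) X] [T2Space X] [SecondCountableTopology X] [ConnectedSpace X], let P : Literature.Geometry.Lorentzian.InitialDataSet (𝓡 3) X → Prop := fun D ↦ (∃ 𝒟 : Literature.Geometry.Lorentzian.VacuumCauchyDevelopment D, 𝒟.IsMaximal) ∧ ∀ 𝒟 : Literature.Geometry.Lorentzian.VacuumCauchyDevelopment D, 𝒟.IsMaximal → Summit.FinalStateConjecture.HasCompleteNullInfinity 𝒟.toCauchyDevelopment ∧ ∃ (O : Set 𝒟.carrier) (d : Literature.Geometry.Lorentzian.FinalStateDecomposition 𝒟.toSpacetime O 2), (∀ i, Literature.Geometry.Lorentzian.Kerr.IsSubextremal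 (d.mass i) (d.spin i)) ∧ O = Summit.FinalStateConjecture.exteriorOf 𝒟.toCauchyDevelopment d.charted ∧ Summit.FinalStateConjecture.RaysStayInClosure 𝒟.toCauchyDevelopment O ∧ Summit.FinalStateConjecture.HasExhaustiveCharts d ∧ Summit.FinalStateConjecture.IsFutureOriented d; let P0 : Literature.Geometry.Lorentzian.InitialDataSet (𝓡 3) X → Prop := fun D ↦ (∃ 𝒟 : Literature.Geometry.Lorentzian.VacuumCauchyDevelopment D, 𝒟.IsMaximal) ∧ ∀ 𝒟 : Literature.Geometry.Lorentzian.VacuumCauchyDevelopment D, 𝒟.IsMaximal → Summit.FinalStateConjecture.HasCompleteNullInfinity 𝒟.toCauchyDevelopment ∧ ∃ (O : Set 𝒟.carrier) (d : Literature.Geometry.Lorentzian.FinalStateDecomposition 𝒟.toSpacetime O 2), d.N = 0 ∧ (∀ i, Literature.Geometry.Lorentzian.Kerr.IsSubextremal (d.mass i) (d.spin i)) ∧ O = Summit.FinalStateConjecture.exteriorOf 𝒟.toCauchyDevelopment d.charted ∧ Summit.FinalStateConjecture.RaysStayInClosure 𝒟.toCauchyDevelopment O ∧ Summit.FinalStateConjecture.HasExhaustiveCharts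 d ∧ Summit.FinalStateConjecture.IsFutureOriented d; let Adh0 : Literature.Geometry.Lorentzian.InitialDataSet (𝓡 3) X → Prop := fun d ↦ ∃ (e : Literature.Geometry.Lorentzian.AFEnd X) (F : EuclideanSpace ℝ (Fin 1) → Literature.Geometry.Lorentzian.InitialDataSet (𝓡 3) X), Literature.Geometry.Lorentzian.InitialDataSet.IsTameDataFamily e 1 F ∧ Literature.Geometry.Lorentzian.InitialDataSet.IsImmersedAtZero 1 F ∧ F 0 = d ∧ (∀ c, F c ∈ Literature.Geometry.Lorentzian.admissibleVacuumData X) ∧ ∃ᶠ c in 𝓝[≠] (0 : EuclideanSpace ℝ (Fin 1)), P0 (F c); ∀ d ∈ Literature.Geometry.Lorentzian.admissibleVacuumData X, ¬ P d → Adh0 d → ∃ (e : Literature.Geometry.Lorentzian.AFEnd X) (F : EuclideanSpace ℝ (Fin 1) → Literature.Geometry.Lorentzian.InitialDataSet (𝓡 3) X), Literature.Geometry.Lorentzian.InitialDataSet.IsTameDataFamily e 1 F ∧ Literature.Geometry.Lorentzian.InitialDataSet.IsImmersedAtZero 1 F ∧ F 0 = d ∧ Injective F ∧ (∀ c, F c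 ∈ Literature.Geometry.Lorentzian.admissibleVacuumData X) ∧ ∀ c ≠ 0, P (F c)

/-- item stmt-FinalStateConjecture-24908 · crux · rank 6 · open · by planner
why it might fail: an as yet unknown STABLE vacuum failure mechanism — a tame-open set of naked-singularity, hairy / exactly-extremal remnant, or eternal bounded-dynamics data (true in Einstein–Klein–Gordon and in D = 5; no vacuum D = 4 candidate known).
sources: Christodoulou1999, arXiv:1912.08478, doi:10.1007/PL00001021, arXiv:2211.15742
[crux] PIECE III — NoStableCounterexample [WEAKER·COUNTS — critic CLEARED 2026-08-30T01:32:59Z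
(«tame density; counts»); kernel-equivalent to «cell III (exceptional data tamely isolated from all
settling data) is curable» (`noStableCounterexample_iff_isolatedCellEmptyCure`); leaf IDEA-NEEDED;
BARRIER placement: HairyKerrBifurcation / GregoryLaflammeInstability show it FALSE in neighbouring
models ⇒ vacuum- and D = 4-specific proof required]. For every Σ and every admissible datum d
failing P_Σ there is a tame (order 1 on one end), immersed-at-0 curve F of admissible data with F 0
= d carrying P_Σ-data at parameters accumulating at 0 (∃ᶠ c in 𝓝[≠] 0, P_Σ (F c)) — the settling
data are tamely dense at every exceptional datum; no counterexample is stable. [difficulty: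
open-problem] -/
@[route_item "route-FinalStateConjecture-RootDecompMultiplicityCells", crux]
def NoStableCounterexample : Prop :=
  ∀ (X : Type) [TopologicalSpace X] [ChartedSpace Literature.Geometry.Lorentzian.E3 X] [IsManifold (𝓡 3) ((⊤ : ℕ∞) : WithTop ℕ∞) X] [T2Space X] [SecondCountableTopology X] [ConnectedSpace X], let P : Literature.Geometry.Lorentzian.InitialDataSet (𝓡 3) X → Prop := fun D ↦ (∃ 𝒟 : Literature.Geometry.Lorentzian.VacuumCauchyDevelopment D, 𝒟.IsMaximal) ∧ ∀ 𝒟 : Literature.Geometry.Lorentzian.VacuumCauchyDevelopment D, 𝒟.IsMaximal → Summit.FinalStateConjecture.HasCompleteNullInfinity 𝒟.toCauchyDevelopment ∧ ∃ (O : Set 𝒟.carrier) (d : Literature.Geometry.Lorentzian.FinalStateDecomposition 𝒟.toSpacetime O 2), (∀ i, Literature.Geometry.Lorentzian.Kerr.IsSubextremal (d.mass i) (d.spin i)) ∧ O = Summit.FinalStateConjecture.exteriorOf 𝒟.toCauchyDevelopment d.charted ∧ Summit.FinalStateConjecture.RaysStayInClosure 𝒟.toCauchyDevelopment O ∧ Summit.FinalStateConjecture.HasExhaustiveCharts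 d ∧ Summit.FinalStateConjecture.IsFutureOriented d; let AdhP : Literature.Geometry.Lorentzian.InitialDataSet (𝓡 3) X → Prop := fun d ↦ ∃ (e : Literature.Geometry.Lorentzian.AFEnd X) (F : EuclideanSpace ℝ (Fin 1) → Literature.Geometry.Lorentzian.InitialDataSet (𝓡 3) X), Literature.Geometry.Lorentzian.InitialDataSet.IsTameDataFamily e 1 F ∧ Literature.Geometry.Lorentzian.InitialDataSet.IsImmersedAtZero 1 F ∧ F 0 = d ∧ (∀ c, F c ∈ Literature.Geometry.Lorentzian.admissibleVacuumData X) ∧ ∃ᶠ c in 𝓝[≠] (0 : EuclideanSpace ℝ (Fin 1)), P (F c); ∀ d ∈ Literature.Geometry.Lorentzian.admissibleVacuumData X, ¬ P d → AdhP d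

/-- item stmt-FinalStateConjecture-26252 · assembly · rank 1 · open · by planner
sources: Christodoulou1999
[assembly] DispersiveThresholdCurable → ScatteringThresholdCurable → PureThresholdCurable →
DegenerateThresholdCurable → NoStableCounterexample → the final state conjecture as typed. -/
@[route_item "route-FinalStateConjecture-RootDecompMultiplicityCells"]
def Assembly : Prop :=
  DispersiveThresholdCurable → ScatteringThresholdCurable → PureThresholdCurable → DegenerateThresholdCurable → NoStableCounterexample → FinalStateConjecture

/-! D-0027 §2.1 — DECIDING THEOREM (planner-authored via `route open/edit --closes-file`; by planner-decomp-fsc-writer-1-g0-0 2026-08-30T03:06:06Z):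
its hypotheses are this route's items and its conclusion the sub-problem Statement (glue_lint), and it elaborates with this file. -/

@[closes "route-FinalStateConjecture-RootDecompMultiplicityCells"] theorem closes (hI : DispersiveThresholdCurable) (hSc : ScatteringThresholdCurable) (hPu : PureThresholdCurable) (hD : DegenerateThresholdCurable) (hIII : NoStableCounterexample) : FinalStateConjecture := by
  intro X _ _ _ _ _ _ d hd
  suffices h : ∃ (e : Literature.Geometry.Lorentzian.AFEnd X) (F : EuclideanSpace ℝ (Fin 1) → Literature.Geometry.Lorentzian.InitialDataSet (𝓡 3) X), Literature.Geometry.Lorentzian.InitialDataSet.IsTameDataFamily e 1 F ∧ Literature.Geometry.Lorentzian.InitialDataSet.IsImmersedAtZero 1 F ∧ F 0 = d ∧ Injective F ∧ (∀ c, F c ∈ Literature.Geometry.Lorentzian.admissibleVacuumData X) ∧ ∀ c ≠ 0, ((∃ 𝒟 : Literature.Geometry.Lorentzian.VacuumCauchyDevelopment (F c), 𝒟.IsMaximal) ∧ ∀ 𝒟 : Literature.Geometry.Lorentzian.VacuumCauchyDevelopment (F c), 𝒟.IsMaximal → Summit.FinalStateConjecture.HasCompleteNullInfinity 𝒟.toCauchyDevelopment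 ∧ ∃ (O : Set 𝒟.carrier) (d : Literature.Geometry.Lorentzian.FinalStateDecomposition 𝒟.toSpacetime O 2), (∀ i, Literature.Geometry.Lorentzian.Kerr.IsSubextremal (d.mass i) (d.spin i)) ∧ O = Summit.FinalStateConjecture.exteriorOf 𝒟.toCauchyDevelopment d.charted ∧ Summit.FinalStateConjecture.RaysStayInClosure 𝒟.toCauchyDevelopment O ∧ Summit.FinalStateConjecture.HasExhaustiveCharts d ∧ Summit.FinalStateConjecture.IsFutureOriented d) by
    obtain ⟨e, F, h1, h2, h3, h4, h5, h6⟩ := h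
    exact ⟨e, F, h1, h2, h3, h4, h5, fun c hc hmem ↦ hmem.2 (h6 c hc)⟩
  have hadh := hIII X d hd.1 hd.2
  by_cases h0 : ∃ (e : Literature.Geometry.Lorentzian.AFEnd X) (F : EuclideanSpace ℝ (Fin 1) → Literature.Geometry.Lorentzian.InitialDataSet (𝓡 3) X), Literature.Geometry.Lorentzian.InitialDataSet.IsTameDataFamily e 1 F ∧ Literature.Geometry.Lorentzian.InitialDataSet.IsImmersedAtZero 1 F ∧ F 0 = d ∧ (∀ c, F c ∈ Literature.Geometry.Lorentzian.admissibleVacuumData X) ∧ ∃ᶠ c in 𝓝[≠] (0 : EuclideanSpace ℝ (Fin 1)), ((∃ 𝒟 : Literature.Geometry.Lorentzian.VacuumCauchyDevelopment (F c), 𝒟.IsMaximal) ∧ ∀ 𝒟 : Literature.Geometry.Lorentzian.VacuumCauchyDevelopment (F c), 𝒟.IsMaximal → Summit.FinalStateConjecture.HasCompleteNullInfinity 𝒟.toCauchyDevelopment ∧ ∃ (O : Set 𝒟.carrier) (d : Literature.Geometry.Lorentzian.FinalStateDecomposition 𝒟.toSpacetime O 2), d.N = 0 ∧ (∀ i, Literature.Geometry.Lorentzian.Kerr.IsSubextremal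 (d.mass i) (d.spin i)) ∧ O = Summit.FinalStateConjecture.exteriorOf 𝒟.toCauchyDevelopment d.charted ∧ Summit.FinalStateConjecture.RaysStayInClosure 𝒟.toCauchyDevelopment O ∧ Summit.FinalStateConjecture.HasExhaustiveCharts d ∧ Summit.FinalStateConjecture.IsFutureOriented d)
  · exact hI X d hd.1 hd.2 h0
  by_cases hrob : ∃ χ : ℝ, χ < 1 ∧ ∃ m : ℝ, 0 < m ∧ ∃ (e : Literature.Geometry.Lorentzian.AFEnd X) (F : EuclideanSpace ℝ (Fin 1) → Literature.Geometry.Lorentzian.InitialDataSet (𝓡 3) X), Literature.Geometry.Lorentzian.InitialDataSet.IsTameDataFamily e 1 F ∧ Literature.Geometry.Lorentzian.InitialDataSet.IsImmersedAtZero 1 F ∧ F 0 = d ∧ (∀ c, F c ∈ Literature.Geometry.Lorentzian.admissibleVacuumData X) ∧ ∃ᶠ c in 𝓝[≠] (0 : EuclideanSpace ℝ (Fin 1)), ((fun D ↦ (∃ 𝒟 : Literature.Geometry.Lorentzian.VacuumCauchyDevelopment D, 𝒟.IsMaximal) ∧ ∀ 𝒟 : Literature.Geometry.Lorentzian.VacuumCauchyDevelopment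 D, 𝒟.IsMaximal → Summit.FinalStateConjecture.HasCompleteNullInfinity 𝒟.toCauchyDevelopment ∧ ∃ (O : Set 𝒟.carrier) (d : Literature.Geometry.Lorentzian.FinalStateDecomposition 𝒟.toSpacetime O 2), (∀ i, Literature.Geometry.Lorentzian.Kerr.IsSubextremal (d.mass i) (d.spin i)) ∧ O = Summit.FinalStateConjecture.exteriorOf 𝒟.toCauchyDevelopment d.charted ∧ Summit.FinalStateConjecture.RaysStayInClosure 𝒟.toCauchyDevelopment O ∧ Summit.FinalStateConjecture.HasExhaustiveCharts d ∧ Summit.FinalStateConjecture.IsFutureOriented d) (F c) ∧ ∃ 𝒟 : Literature.Geometry.Lorentzian.VacuumCauchyDevelopment (F c), 𝒟.IsMaximal ∧ ∃ (O : Set 𝒟.carrier) (d : Literature.Geometry.Lorentzian.FinalStateDecomposition 𝒟.toSpacetime O 2), (∀ i, Literature.Geometry.Lorentzian.Kerr.IsSubextremal (d.mass i) (d.spin i)) ∧ O = Summit.FinalStateConjecture.exteriorOf 𝒟.toCauchyDevelopment d.charted ∧ Summit.FinalStateConjecture.RaysStayInClosure 𝒟.toCauchyDevelopment O ∧ Summit.FinalStateConjecture.HasExhaustiveCharts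 d ∧ Summit.FinalStateConjecture.IsFutureOriented d ∧ ∀ i, |d.spin i| ≤ χ * d.mass i ∧ m ≤ d.mass i)
  · exact (Classical.em _).elim (fun hJ ↦ hSc X d hd.1 hd.2 ⟨⟨hrob, h0⟩, hJ⟩) (fun hJ ↦ hPu X d hd.1 hd.2 ⟨⟨hrob, h0⟩, hJ⟩)
  · exact hD X d hd.1 hd.2 ⟨hadh, hrob⟩

end Summit.FinalStateConjecture.FinalStateConjecture.Theses.RootDecompMultiplicityCells
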